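import Literature.NumberTheory.EllipticCurves.HeegnerPointsKolyvaginStructure
import Literature.NumberTheory.EllipticCurves.Tamagawa
import HarnessLib

/-!
# Burungale–Castella–Grossi–Skinner 2026, Theorem 2: the refined Kolyvagin conjecture
# `𝓜_∞ = Σ_{ℓ ∣ N} ord_p(c_ℓ)` (W. Zhang 2014) for SURJECTIVE `ρ̄_{E,p}`, `p > 3` good ordinary,
# `p` split in `K` — statement-only named fact in the tree's `c_M(n)` vocabulary

Source (read 2026-08-27 on the held text `paper:arxiv-2312.09301` = the arXiv TeX source of the
version of record, chunk locators `pNNNN Lnn` = 3000-character chunks of that text, NOT journal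
pages): A. Burungale, F. Castella, G. Grossi, C. Skinner, *Non-vanishing of Kolyvagin systems and
Iwasawa theory*, Camb. J. Math. **14** (2026) no. 2, 285–348 = arXiv:2312.09301 [`BurungaleEtAl2026`].
One file for the one item of the paper's §0.1 "Main results" that the tree lacked BY NAME (work item
wi-81585, wanted by the cell `bsd-f3-mu`; D-0064): **Theorem 2** (the refined Kolyvagin conjecture)
as a statement-only named fact. Already in the tree and NOT restated: **Theorem 1** (Kolyvagin's
conjecture, the unconditional case `p > 3` + (irr)) =
`Literature.NumberTheory.EllipticCurves.BurungaleEtAl2026_exists_kolyvaginClass_ne_zero` and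
**Corollary 1** (`ord κ = max{r⁺, r⁻} − 1`, through Kolyvagin's structure theorem) =
`Literature.NumberTheory.EllipticCurves.Kolyvagin1991_selmerCorank_of_kolyvaginClass_ne_zero`
(file `HeegnerPointsKolyvaginStructure`); the objects (`KolyvaginHeegnerData`, `derivedPoint` =
`Σ_{σ∈S} σ D_n y(n)`, `kolyvaginClass` = `c_M(n)`, `Zhang2014.IsKolyvaginPrime`, `kolyvaginIndex` =
`M(ℓ)`, `levelIndex` = `M(n)`, `KolyvaginDescent.KolSupp` = "`n ∈ 𝒩_Heeg`") are those of
`HeegnerPointsOfConductor` / `HeegnerPointsKolyvaginEulerSystem`; `W.tamagawaProduct = ∏_ℓ c_ℓ` is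
the BSD currency of `Tamagawa` / `BSDInvariants`.

## The printed statements (verbatim, with locators)

* §0.1, setting [p0003 L17–L25]: *"Let `K` be an imaginary quadratic field of discriminant
  `−D_K < 0` such that (Heeg) every prime `ℓ | N` splits in `K`, and fix an integral ideal `𝔑 ⊂ 𝒪_K`
  with `𝒪_K/𝔑 = ℤ/Nℤ`. Assume also that (disc) `D_K` is odd and `D_K ≠ −3`."*; [L38–L46] *"Fix a
  modular parameterisation (par) `π : X₀(N) → E`. The Heegner point of conductor `m` is defined by
  `P[m] := π(x_m) ∈ E(K[m])`."*; [L48–L58] *"We call `ℓ` a Kolyvagin prime if `ℓ` is inert in `K`,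
  coprime to `Np`, and `M(ℓ) := min{ord_p(ℓ+1), ord_p(a_ℓ)} > 0 … Let `𝒩_Heeg` be the set of
  squarefree products of Kolyvagin primes, and for `n ∈ 𝒩_Heeg` put `M(n) := min{M(ℓ) : ℓ ∣ n}` if
  `n > 1` and `M(1) := ∞`."*; [L60–L70] *"Let `T = T_pE` … suppose that (tor) `E(K)[p] = 0`. From
  the Kummer images of the Heegner points `P[n]`, Kolyvagin constructed a system of classes
  `{κ_n^Heeg ∈ H¹(K, T/I_nT) : n ∈ 𝒩_Heeg}`, where `I_n = p^{M(n)}ℤ_p`."*; §1.1.2 [p0008 L48–L69]: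
  *"`D_ℓ = Σ_{i=1}^{ℓ} iσ_ℓ^i` … `κ̃_n := Σ_{σ∈S} σ D_n(P[n]) ∈ (E(K[n])/p^{M(n)}E(K[n]))^{𝒢(n)}` …
  applying the Kummer map … the derived Heegner class `κ_n^Heeg` is defined to be the unique class in
  `H¹(K, T^{(M(n))})` which restricts to the image of `κ̃_n`"* (`T^{(k)} = T/p^kT ≃ E[p^k]`).
* **Theorem 1** [p0003 L129–L142]: *"Let `E/ℚ` be an elliptic curve, and let `p` be an odd prime of
  good ordinary reduction for `E`. Let `K` be a quadratic imaginary field satisfying (Heeg), (disc),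
  (tor), and such that `p` splits in `K`. Assume that the rational anticyclotomic Main Conjecture
  holds. Then there exists `n ∈ 𝒩_Heeg` such that `κ_n^Heeg ≠ 0`. In particular, `{κ_n^Heeg} ≠ 0`
  in both of the following cases: ∘ `E` admits a rational `p`-isogeny with kernel `𝔽_p(φ) ⊂ E[p]`,
  where … `φ|_{G_p} ≠ 𝟙, ω`. ∘ `p > 3` satisfies (irr) [`E[p]` is an irreducible `G_ℚ`-module]."*
* §0.1 "Refined Kolyvagin's conjecture" [p0004 L41–L63]: *"a natural refinement of Kolyvagin's
  conjecture predicts a formula for the divisibility index of the Heegner point Kolyvagin system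
  `{κ_n^Heeg}` in terms of the Tamagawa numbers `c_ℓ = [E(ℚ_ℓ) : E⁰(ℚ_ℓ)]` at the primes `ℓ | N`. For
  each `n ∈ 𝒩_Heeg`, define `𝓜(n) ∈ ℤ_{≥0} ∪ {∞}` by `𝓜(n) = ∞` if `κ_n^Heeg = 0`, and by
  `𝓜(n) = max{𝓜 : κ_n^Heeg ∈ p^𝓜 H¹(K, T/I_nT)}` otherwise. Put `𝓜_r = min{𝓜(n) : ν(n) = r}`. We
  have `𝓜_r ≥ 𝓜_{r+1} ≥ 0` for all `r ≥ 0` (cf. [Kolyvagin 1991]). Put `𝓜_∞ = lim_{r→∞} 𝓜_r`. Note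
  that Kolyvagin's conjecture is equivalent to the finiteness of `𝓜_∞`."* (`ν(n)` = the number of
  prime factors of `n`, p0004 L8.)
* **Theorem 2 (Refined Kolyvagin's conjecture)** [p0004 L68–L77]: *"Let `(E, p, K)` be as in
  Theorem 1, and assume that `p > 3` and (sur) holds. Assume also that the fixed modular
  parametrisation `π : X₀(N) → E` as in (par) is `p`-optimal [footnote: That is `ord_p(deg(π))` is
  minimal among all modular parametrisations of all curves in the `ℚ`-isogeny class of `E`.]. Then
  we have `𝓜_∞ = Σ_{ℓ∣N} ord_p(c_ℓ)`."* — followed by [L80] *"In the rank one case Theorem 2 implies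
  the `p`-part of the conjectural Birch and Swinnerton-Dyer formula for `E/K` (cf. [W. Zhang 2014])"*
  and [L88–L92] *"In [Jetchev 2008] Jetchev showed that `𝓜_∞ ≥ ord_p(c_ℓ)` for any prime `ℓ | N`."*
* WHICH IMAGE HYPOTHESIS — (sur), NOT (irr). The held text is the TeX source, in which Theorem 2
  reads *"assume that `p>3` and (eq:irred) holds"*, with two distinct labels in play: `eq:irr` = the
  display tagged **(irr)** *"`E[p]` is an irreducible `G_ℚ`-module"* [p0003 L104–L106] and `eq:irred`
  = the display tagged **(sur)** *"`ρ̄_E : G_ℚ → Aut_{𝔽_p}(E[p])` is surjective"* [p0003 L91–L93; the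
  sentence after it: *"we prove Kolyvagin's conjecture in cases where (eq:irred) is not necessarily
  satisfied"*]. The identification `eq:irred = (sur)` is forced by Thm. 1.2.12 [p0013 L5–L10]: *"(ii)
  If `p>3` satisfies (eq:irr), then the rational anticyclotomic Main Conjecture holds. (iii) If
  `p>3` satisfies (eq:irred), then Conjecture 1.2.10 holds. Proof. … in [BCS] in situations (ii) and
  (iii)"*, against the printed Theorem 1.2.2 of Burungale–Castella–Skinner, IMRN 2025 =
  arXiv:2405.00270 (held `paper:arxiv-2405.00270`, p0003 L36–L58): *"(a) If `p > 3` satisfies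
  (irr_ℚ), then … [the equality] in `Λ⁻_K ⊗ ℚ_p`. (b) If further `p > 3` satisfies (sur), then the
  equality holds in `Λ⁻_K`"*; and by the authors' sequel (Castella et al., arXiv:2601.14504, held
  `paper:arxiv-2601.14504`, p0003 L14–L16, p0005 L28–L49) whose only image display is (sur), again
  labelled `eq:irred`, in *"Conjecture 3 / Theorem 3 (Refined Kolyvagin's conjecture). Let `p > 3` be
  a prime such that (eq:irred) and (manin) both hold …"*. The proof of Theorem 2 [p0017 L16–L17:
  *"Assume (eq:irred), `p>3` and Conjecture 1.2.10"*] uses the INTEGRAL anticyclotomic Main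
  Conjecture, i.e. case (iii). The work item's reading "irreducible, no surjectivity" came from the
  label name and is NOT what is printed; this file types (sur) (R2-G44: hypotheses verbatim).
  Under (sur) and `p > 3` the "rational anticyclotomic Main Conjecture" clause of Theorem 1 is a
  theorem of the source's references (Thm. 1.2.12 (ii)/(iii)), so Theorem 2 is unconditional and
  carries no Main-Conjecture binder below.
* VERSION OF RECORD vs the held text (recorded 2026-08-27 after landing, docstring only; statements
  unchanged). The held `paper:arxiv-2312.09301` is an EARLIER arXiv version. The latest arXiv source
  (e-print gzip dated 2026-01-21, one file `Koly_revised.tex`, sha16 `19e1a73c9d1dda24`; this seat's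
  jail cannot fetch e-prints — read first-hand by the seat `bsd-print-x9-lit g4` and quoted in
  `run/shared/lean/pub/bsd-print-x9/DOSSIER.md` §18.6, which is the source of the next three
  quotations) (a) confirms the label map AT THE SOURCE: l.409–411 `\label{eq:irred} \tag{sur}`
  «`ρ̄_E : G_ℚ → Aut_{𝔽_p}(E[p])` is surjective», l.422–424 `\label{eq:irr} \tag{irr}` «`E[p]` is an
  irreducible `G_ℚ`-module»; (b) prints Theorem 2 (l.548–558) with ONE MORE SENTENCE than the held
  version: «Let `(E,p,K)` be as in Theorem 1, and assume that `p>3` and (sur) holds. Assume that the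
  integral anticyclotomic Main Conjecture [Conj. 1.2.10: `X_Gr(E/K_∞)` is `Λ`-torsion and
  `char_Λ(X_Gr)Λ^ur = (𝓛_p^BDP(f/K)²)`] holds. Assume also that the fixed modular parametrisation
  `π : X₀(N) → E` … is `p`-optimal. Then `𝓜_∞ = Σ_{ℓ∣N} ord_p(c_ℓ)`»; (c) keeps Theorem 1.2.12
  (l.1594–1602): «(iii) If `p>3` satisfies (sur), then Conjecture 1.2.10 holds» (proof: [BCS] =
  Burungale–Castella–Skinner, IMRN 2025, Thm. 1.2.4 (b) — tree record
  `BurungaleCastellaSkinner2025.thm124b_exists_isBDPLFunction_isTorsion_charIdeal_eq`, whose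
  hypotheses `E/ℚ`, `p > 3` good ordinary, (disc), (Heeg), (spl), (sur) are all among Theorem 2's).
  HENCE the fact below is, word for word, THEOREM 2 OF THE VERSION OF RECORD COMPOSED WITH THE SAME
  PAPER'S THEOREM 1.2.12 (iii): the explicit Main-Conjecture sentence is discharged inside the paper
  under Theorem 2's remaining hypotheses, which are carried verbatim; no Main-Conjecture binder is
  carried (the bsd-print-x9 desk's standard for a record typing, DOSSIER §18.6: «`Surj W p` + the
  integral ac-MC (or (iii)) + `p`-optimality verbatim» — this file takes the «(iii)» branch and says
  so). PROVENANCE (informational, inherited, nothing hidden): the printed proof of BCS 2025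
  Thm. 1.2.4 passes through the preprint [BSTW23] (tree flag `BCS25-IMC-equiv@BSTW`, file
  `BurungaleCastellaSkinner2025/BDPMainConjecture.lean`); a consumer who prefers the Main Conjecture
  as an explicit input takes `(hIMC : BurungaleCastellaSkinner2025.thm124b_…)` next to this fact.

## Transcription (weaker than print where it differs, never stronger)

* `E` = a globally minimal `W/ℚ` (`a_ℓ = W.frobeniusTrace ℓ`, `N = W.conductorNorm ℤ`), `3 < p`,
  good (`W.HasGoodReductionAtPrime p`) ordinary (`p ∤ a_p`) reduction, (sur) =
  `W.HasSurjectiveModNGaloisRep p` (mod `p`, as printed); `K` imaginary quadratic with (Heeg) =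
  `SatisfiesHeegnerHypothesis N K`, (disc) = `Odd d_K ∧ d_K ≠ −3`, (tor) = `E(K)[p] = 0`
  (`AddSubgroup.torsionBy … p = ⊥`), `p` split in `K` = `SatisfiesHeegnerHypothesis p K` — the
  binders of the Theorem 1 record VERBATIM, plus (sur).
* `π` ↦ a parametrisation datum `Dt : ModularParametrizationData W N` (its `φ = uniformize ∘ (c ·
  2πi∫f)`, Manin constant `Dt.maninConstant`, degree `Dt.modularDegree`); "`p`-optimal" ↦
  `Dt.IsPOptimal p` := `ord_p(Dt.modularDegree) ≤ ord_p(Dt'.modularDegree)` for every datum `Dt'` of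
  every elliptic `W'/ℚ` at level `N` with the SAME newform `Dt'.f = Dt.f` — the isogeny-free
  phrasing of "all curves in the `ℚ`-isogeny class" already used by the tree for the minimal modular
  degree (`ModularParametrizationData.abs_maninConstant_eq_one_of_isSemistable`, file `ModularCurve`;
  `CongruenceNumber` design notes): the curves with newform `f` are exactly the `ℚ`-isogeny class
  (Faltings), and every printed parametrisation `π'` of such a curve is such a datum (`π'^*ω =
  c'·2πi f dz`, `deg` = `deg π'`), so the tree hypothesis implies the printed one (a possibly LARGER
  comparison set only strengthens the hypothesis, i.e. weakens the fact). `𝔑` ↦ an orientation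
  `β`, `β² ≡ d_K (mod 4N)`; the embedding `K ⊂ ℂ` ↦ `ι`.
* `κ_n^Heeg` for `n ∈ 𝒩_Heeg`, `n ≠ 1` ↦ `d.kolyvaginClass _ M(n) ∈ H¹(K, E[p^{M(n)}])`
  (`galH1Torsion (W⁄K) (p^{M(n)})`) for a Kolyvagin–Heegner datum `d` of conductor `n` on the frame
  `(Dt, β, ι)` — the descended Kummer class of `P(n) = Σ_{σ∈S} σ D_n y(n)`, i.e. of the printed
  `κ̃_n`, exactly as in the Theorem 1 record (the "slight modification" of §1.1.2 after which the
  classes form a Kolyvagin system in Howard's sense multiplies classes by units of `ℤ/p^{M(n)}` and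
  does not change divisibility; §0.1 defines `𝓜(n)` on the classes "from the Kummer images"). The
  printed Kolyvagin primes ("inert, coprime to `Np`, `M(ℓ) > 0`") are the tree's
  `Zhang2014.IsKolyvaginPrime N W K p` (`ℓ ∤ N`, `ℓ ∤ d_K`, `ℓ ≠ p`, `(ℓ)` prime, `0 < M(ℓ)`).
* `𝓜_∞ = t` ↦ the pair 【every `κ_n^Heeg`, `n ∈ 𝒩_Heeg ∖ {1}`, lies in `p^t H¹(K, E[p^{M(n)}])`】 ∧
  【some `κ_n^Heeg`, `n ∈ 𝒩_Heeg ∖ {1}`, does not lie in `p^{t+1} H¹(K, E[p^{M(n)}])`】. DERIVATION from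
  the printed definitions (three lines, using only the monotonicity `𝓜_r ≥ 𝓜_{r+1}` that the source
  records at p0004 L55): the sequence `𝓜_r` is non-increasing with limit `t < ∞`, so `𝓜_r ≥ t` for
  every `r` and `𝓜_r = t` for all `r ≥ r₀`, some `r₀ ≥ 1`; hence `𝓜(n) ≥ 𝓜_{ν(n)} ≥ t` for every
  `n` (first clause) and some `n` with `ν(n) ≥ 1` has `𝓜(n) = t`, i.e. `κ_n ∈ p^t H¹ ∖ p^{t+1} H¹`
  (second clause). Conversely the pair gives `𝓜_r ≥ t` for `r ≥ 1` and `𝓜_{ν(n)} ≤ t`, whence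
  `𝓜_r = t` for `r ≥ ν(n)` and `𝓜_∞ = t`; so modulo the printed monotonicity nothing is lost. The
  level `n = 1` (`κ_1 ∈ H¹(K, T)`, `I_1 = 0`) is left out on purpose: it needs `H¹(K, T_pE)`, and
  `inf_{r ≥ 1} 𝓜_r = inf_{r ≥ 0} 𝓜_r` by monotonicity. The choices inside a datum (`σ_ℓ`, `S`,
  `K[n] → K̄`) are the source's arbitrary fixed choices; the divisibility of `κ_n` does not depend on
  them, so both clauses are stated for every datum / some datum.
* `Σ_{ℓ∣N} ord_p(c_ℓ)` ↦ `padicValNat p W.tamagawaProduct` = `ord_p(∏_v c_v)` over all finite places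
  of `ℚ` (`Tamagawa`): `c_ℓ = 1` for `ℓ ∤ N` and every `c_ℓ ≥ 1`, so `ord_p ∏_ℓ c_ℓ = Σ_{ℓ∣N}
  ord_p c_ℓ`; this is the form `𝓜_∞(κ^Heeg) = ord_p(Tam_E)` printed in the sequel
  (arXiv:2601.14504, Conjecture 3 / Theorem 3).
* NOT typed here (separate statements, separate facts if ever wanted): the sentence "in the rank one
  case Theorem 2 implies the `p`-part of the BSD formula for `E/K`" (it goes through Kolyvagin's
  structure theorem — tree records `McCallum1991_*`, `Cha2005.rmk25_*`, `KolyvaginShaStructure*` —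
  whose POINT-divisibility currency `P(n) ∈ p^s E(K[n])` is related to the CLASS currency used here
  and in print only through that theorem); Theorem 3 / the refined statement for Kato's Kolyvagin
  system (§0.1, "Non-vanishing of Kato's Kolyvagin system"); the sequel's `p` inert case.

Size XL (BDP `p`-adic `L`-function and explicit reciprocity law, the Kolyvagin-system bound with
error terms, anticyclotomic control, the integral anticyclotomic Main Conjecture of
Burungale–Castella–Skinner, Kolyvagin's structure arguments of §2.2); no `_holds` is expected. Nothing
is asserted: users take `(h : thm2_kolyvaginClass_divisibility_eq_padicValNat_tamagawaProduct)`.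

## Contents

* `ModularParametrizationData.IsPOptimal` — the footnote's "`p`-optimal parametrisation" (a
  predicate on a datum; unfolding lemma `isPOptimal_iff`; `IsPOptimal.of_minimal`: a datum of minimal
  modular degree is `p`-optimal for every `p`).
* `thm2_kolyvaginClass_divisibility_eq_padicValNat_tamagawaProduct` — the named fact (Thm. 2).
* `kolyvaginClass_divisible_of_thm2` — PROVED: the "`𝓜_∞ ≥ Σ ord_p c_ℓ`" half at any depth
  `s ≤ ord_p(∏ c_ℓ)` (every `κ_n`, `n ≠ 1`, is `p^s`-divisible), the shape in which the tree's
  structure-theorem records consume divisibility.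
* `exists_kolyvaginClass_ne_zero_of_thm2` — PROVED: Thm. 2 ⇒ some `κ_n ≠ 0` (*"Kolyvagin's
  conjecture is equivalent to the finiteness of `𝓜_∞`"*, p0004 L63), the (sur)-companion of the
  Theorem 1 record.

## References

* [BurungaleEtAl2026] A. Burungale, F. Castella, G. Grossi, C. Skinner, Camb. J. Math. 14 (2026)
  285–348 = arXiv:2312.09301: §0.1 (Heeg)/(disc)/(par)/(tor)/(sur)/(irr), Kolyvagin primes, `𝒩_Heeg`,
  `M(n)`, `κ_n^Heeg`, Thm. 1, Cor. 1, `𝓜(n)`, `𝓜_r`, `𝓜_∞`, **Thm. 2** with its footnote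
  (held text p0003 L17–L142, p0004 L1–L92); §1.1.2 (p0008 L14–L80); Conj. 1.2.10 and Thm. 1.2.12
  (p0012 L70 – p0013 L10); §2.2 and the proof of Thm. 2 (p0014 L84 – p0017 L38).
* [BurungaleCastellaSkinner2025] A. Burungale, F. Castella, C. Skinner, *Base change and Iwasawa main
  conjectures for GL₂*, IMRN 2025 = arXiv:2405.00270, Thm. 1.2.2 (a)/(b) (the (irr_ℚ)/(sur) split).
* F. Castella et al., *On refined nonvanishing conjectures by Kurihara and Kolyvagin*,
  arXiv:2601.14504 (2026), Conj. 3 / Thm. 3 (`𝓜_∞(κ^Heeg) = ord_p(Tam_E)`; (sur)).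
* [WZhang2014] W. Zhang, Camb. J. Math. 2 (2014) 191–253 (the conjecture; `M(ℓ)`, `c_M(n)`).
* [Jetchev2008] D. Jetchev, Compos. Math. 144 (2008) 811–826 (`𝓜_∞ ≥ ord_p c_ℓ`; tree record
  `Jetchev2008.thm14_derivedPoint_divisible_of_le_padicValNat_tamagawa`, point currency).
* [GrossLMS1991] B. H. Gross, *Kolyvagin's work on modular elliptic curves*, §§3–4 (the objects).
-/

noncomputable section

open scoped Classical

open WeierstrassCurve Literature.NumberTheory.EllipticCurves.ModularForms

namespace Literature.NumberTheory.EllipticCurves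

namespace ModularForms.ModularParametrizationData

variable {W : WeierstrassCurve ℚ} {N : ℕ} [NeZero N]

/-- **`p`-optimal modular parametrisation** (Burungale–Castella–Grossi–Skinner 2026, footnote to
Thm. 2: *"That is `ord_p(deg(π))` is minimal among all modular parametrisations of all curves in
the `ℚ`-isogeny class of `E`."*), for a parametrisation datum `Dt` of `W` at level `N`:
`ord_p(Dt.modularDegree) ≤ ord_p(Dt'.modularDegree)` for every parametrisation datum `Dt'`, at the
same level and with the same newform `Dt'.f = Dt.f`, of every elliptic `W'/ℚ` — the isogeny-free
phrasing of "the `ℚ`-isogeny class of `E`" used by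
`ModularParametrizationData.abs_maninConstant_eq_one_of_isSemistable` for the minimal degree (the
elliptic curves with newform `f` form one `ℚ`-isogeny class, Faltings).
[cite: BurungaleEtAl2026, Thm. 2, footnote (arXiv:2312.09301 §0.1)] -/
def IsPOptimal (Dt : ModularParametrizationData W N) (p : ℕ) : Prop :=
  ∀ (W' : WeierstrassCurve ℚ) [W'.IsElliptic] (Dt' : ModularParametrizationData W' N),
    Dt'.f = Dt.f → padicValNat p Dt.modularDegree ≤ padicValNat p Dt'.modularDegree

/-- Unfolding of `IsPOptimal`. [cite: BurungaleEtAl2026, Thm. 2, footnote] -/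
theorem isPOptimal_iff (Dt : ModularParametrizationData W N) (p : ℕ) :
    Dt.IsPOptimal p ↔
      ∀ (W' : WeierstrassCurve ℚ) [W'.IsElliptic] (Dt' : ModularParametrizationData W' N),
        Dt'.f = Dt.f → padicValNat p Dt.modularDegree ≤ padicValNat p Dt'.modularDegree :=
  Iff.rfl

/-- **The optimal parametrisation is `p`-optimal for every `p`.** If `Dt.modularDegree` divides
`Dt'.modularDegree` for every datum `Dt'` with the same newform (the printed mechanism behind the
footnote: every parametrisation of a curve in the class factors through the optimal quotient
`X₀(N) → E₀`, so its degree is a multiple of the optimal degree — here a hypothesis), then `Dt` is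
`p`-optimal: `p^{ord_p deg} ∣ deg ∣ deg'` and `deg' > 0`. [cite: BurungaleEtAl2026, Thm. 2, footnote] -/
theorem IsPOptimal.of_dvd (Dt : ModularParametrizationData W N) (p : ℕ) [Fact p.Prime]
    (hdvd : ∀ (W' : WeierstrassCurve ℚ) [W'.IsElliptic] (Dt' : ModularParametrizationData W' N),
      Dt'.f = Dt.f → Dt.modularDegree ∣ Dt'.modularDegree) :
    Dt.IsPOptimal p := by
  intro W' _ Dt' hf
  have h0 : Dt'.modularDegree ≠ 0 := Dt'.deg_pos.ne'
  exact (padicValNat_dvd_iff_le h0).mp (dvd_trans pow_padicValNat_dvd (hdvd W' Dt' hf))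

end ModularForms.ModularParametrizationData

namespace BurungaleEtAl2026

/-- **Burungale–Castella–Grossi–Skinner 2026, Theorem 2 — W. Zhang's refined divisibility-index
formula `𝓜_∞ = Σ_{ℓ∣N} ord_p(c_ℓ)` for the Heegner-point Kolyvagin system (posed by W. Zhang in
2014; a THEOREM of the source) for surjective `ρ̄_{E,p}`.** Verbatim (Camb. J. Math. 14 (2026),
§0.1, "Theorem 2", whose printed title names W. Zhang's refinement of Kolyvagin's 1991 question;
arXiv:2312.09301, held text p0004 L68–L77): *"Let `(E, p, K)` be as in Theorem 1
[`E/ℚ` an elliptic curve, `p` an odd prime of good ordinary reduction for `E`, `K` a quadratic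
imaginary field satisfying (Heeg) [every prime `ℓ | N` splits in `K`], (disc) [`D_K` is odd and
`D_K ≠ −3`], (tor) [`E(K)[p] = 0`], and such that `p` splits in `K`], and assume that `p > 3` and
(sur) [`ρ̄_E : G_ℚ → Aut_{𝔽_p}(E[p])` is surjective — TeX label `eq:irred`; see the module
docstring for why this is (sur) and not (irr)] holds. Assume also that the fixed modular
parametrisation `π : X₀(N) → E` as in (par) is `p`-optimal [that is `ord_p(deg(π))` is minimal
among all modular parametrisations of all curves in the `ℚ`-isogeny class of `E`]. Then we have
`𝓜_∞ = Σ_{ℓ∣N} ord_p(c_ℓ)`."* — the version of record (arXiv source of 2026-01-21 = the journal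
text) inserts before the `p`-optimality sentence «Assume that the integral anticyclotomic [Iwasawa] Main
Conj. [their 1.2.10] holds.», a hypothesis DISCHARGED IN THE SAME PAPER under the other
hypotheses of Theorem 2 by its Theorem 1.2.12 (iii) «If `p>3` satisfies (sur), then Conj.
1.2.10 holds» (= Burungale–Castella–Skinner 2025 Thm. 1.2.4 (b), tree record
`BurungaleCastellaSkinner2025.thm124b_exists_isBDPLFunction_isTorsion_charIdeal_eq`); this fact is
Theorem 2 ∘ Theorem 1.2.12 (iii) and carries no Main-Conj. binder (module docstring, "VERSION
OF RECORD") —, where (p0004 L47–L60) `𝓜(n) = max{𝓜 : κ_n^Heeg ∈ p^𝓜 H¹(K, T/I_nT)}`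
(`= ∞` if `κ_n^Heeg = 0`), `I_n = p^{M(n)}ℤ_p`, `𝓜_r = min{𝓜(n) : ν(n) = r}`, `𝓜_r ≥ 𝓜_{r+1}`,
`𝓜_∞ = lim_r 𝓜_r`, and `c_ℓ = [E(ℚ_ℓ) : E⁰(ℚ_ℓ)]`.
TRANSCRIPTION (module docstring): `W/ℚ` globally minimal, `3 < p` good ordinary, `ρ̄_{E,p}` onto
(mod `p`); `K` imaginary quadratic, Heegner for `N = W.conductorNorm ℤ`, `d_K` odd, `d_K ≠ −3`,
`E(K)[p] = 0`, `p` split in `K`; for EVERY `p`-optimal parametrisation datum `Dt` at level `N`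
(`Dt.IsPOptimal p`), every orientation `β` (`β² ≡ d_K (mod 4N)`, the paper's `𝔑`) and embedding `ι`:
(≥) for every `n ∈ 𝒩_Heeg`, `n ≠ 1` (square-free product of Kolyvagin primes,
`KolyvaginDescent.KolSupp (Zhang2014.IsKolyvaginPrime N W K p) n`) and every Kolyvagin–Heegner datum `d`
of conductor `n`, the class `κ_n^Heeg = c_{M(n)}(n) = d.kolyvaginClass _ M(n) ∈ H¹(K, E[p^{M(n)}])`
is divisible by `p^t`, AND (≤) for some such `n ≠ 1` and `d` it is NOT divisible by `p^{t+1}`,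
where `t = ord_p(∏_ℓ c_ℓ) = padicValNat p W.tamagawaProduct` (`= Σ_{ℓ∣N} ord_p c_ℓ`, `c_ℓ = 1` off
`N`). This pair is `𝓜_∞ = t` read through the printed monotonicity `𝓜_r ≥ 𝓜_{r+1}` (three-line
derivation in the module docstring; the level `n = 1`, `κ_1 ∈ H¹(K, T_pE)`, is omitted — it does not
change `inf_r 𝓜_r`). Weaker than print where it differs (isogeny-free `p`-optimality over a possibly
larger comparison set), never stronger. Size XL; no `_holds` expected; nothing asserted — users take
`(h : thm2_kolyvaginClass_divisibility_eq_padicValNat_tamagawaProduct)`.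
[cite: BurungaleEtAl2026, Thm. 2 with footnote (version of record: arXiv source 2026-01-21 ll. 548–558), and §0.1 (Heeg)/(disc)/(par)/(tor)/(sur) (ll. 409–411), 𝒩_Heeg, M(n), κ_n, 𝓜(n), 𝓜_r, 𝓜_∞ (held text p0003 L17–L142, p0004 L40–L92); §1.1.2 (κ̃_n, κ_n); Conj. 1.2.10 and Thm. 1.2.12 (iii) (ll. 1558–1566, 1594–1602; held p0012 L70 – p0013 L10); proof of Thm. 2 (§2.2)]
[cite: BurungaleCastellaSkinner2025, Thm. 1.2.4 (b) (the source of Thm. 1.2.12 (iii))]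
[cite: WZhang2014, Notations (xii) (M(ℓ), Kolyvagin primes, c_M(n)) and §3.7 (3.21)]
[cite: GrossLMS1991, §3–§4 (4.1), (4.4)] -/
def thm2_kolyvaginClass_divisibility_eq_padicValNat_tamagawaProduct : Prop :=
  ∀ (W : WeierstrassCurve ℚ) [W.IsElliptic] [W.IsGloballyMinimal] (p : ℕ) [hp : Fact p.Prime],
    3 < p → W.HasGoodReductionAtPrime p → ¬ (p : ℤ) ∣ W.frobeniusTrace p →
    W.HasSurjectiveModNGaloisRep p →
    ∀ (K : Type) [Field K] [NumberField K], IsImaginaryQuadratic K →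
      ∀ [NeZero (W.conductorNorm ℤ)], SatisfiesHeegnerHypothesis (W.conductorNorm ℤ) K →
      Odd (NumberField.discr K) → NumberField.discr K ≠ -3 →
      AddSubgroup.torsionBy (W.baseChange K).toAffine.Point (p : ℤ) = ⊥ →
      SatisfiesHeegnerHypothesis p K →
      ∀ (Dt : ModularParametrizationData W (W.conductorNorm ℤ)), Dt.IsPOptimal p →
      ∀ (β : ℤ), (4 * (W.conductorNorm ℤ : ℤ)) ∣ β ^ 2 - NumberField.discr K →
      ∀ (ι : K →+* ℂ),
        (∀ (n : ℕ) (d : KolyvaginHeegnerData Dt β ι n) (M : ℕ), n ≠ 1 →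
            KolyvaginDescent.KolSupp (Zhang2014.IsKolyvaginPrime (W.conductorNorm ℤ) W K p) n →
            (M : ℕ∞) = Zhang2014.levelIndex W p n →
            ∃ ξ : galH1Torsion (W.baseChange K) ((p ^ M : ℕ) : ℤ),
              ((p ^ padicValNat p W.tamagawaProduct : ℕ) : ℤ) • ξ = d.kolyvaginClass hp.out M) ∧
        (∃ (n : ℕ) (d : KolyvaginHeegnerData Dt β ι n) (M : ℕ), n ≠ 1 ∧
            KolyvaginDescent.KolSupp (Zhang2014.IsKolyvaginPrime (W.conductorNorm ℤ) W K p) n ∧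
            (M : ℕ∞) = Zhang2014.levelIndex W p n ∧
            ¬ ∃ ξ : galH1Torsion (W.baseChange K) ((p ^ M : ℕ) : ℤ),
              ((p ^ (padicValNat p W.tamagawaProduct + 1) : ℕ) : ℤ) • ξ = d.kolyvaginClass hp.out M)

/-- **The "`𝓜_∞ ≥ Σ_{ℓ∣N} ord_p(c_ℓ)`" half of Theorem 2 at any depth `s ≤ ord_p(∏_ℓ c_ℓ)`** (PROVED
from the fact): under the hypotheses of Theorem 2, every class `κ_n^Heeg = c_{M(n)}(n)`, `n ≠ 1` a
square-free product of Kolyvagin primes, is `p^s`-divisible in `H¹(K, E[p^{M(n)}])`. For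
`s = ord_p(c_ℓ)`, `ℓ ∣ N`, this is the class-currency form of Jetchev's `𝓜_∞ ≥ ord_p(c_ℓ)` (p0004
L88–L90); the sum over ALL `ℓ ∣ N` is what Theorem 2 adds.
[cite: BurungaleEtAl2026, Thm. 2 (§0.1)] -/
theorem kolyvaginClass_divisible_of_thm2
    (h : thm2_kolyvaginClass_divisibility_eq_padicValNat_tamagawaProduct)
    (W : WeierstrassCurve ℚ) [W.IsElliptic] [W.IsGloballyMinimal] (p : ℕ) [hp : Fact p.Prime]
    (h3 : 3 < p) (hgood : W.HasGoodReductionAtPrime p) (hord : ¬ (p : ℤ) ∣ W.frobeniusTrace p)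
    (hsur : W.HasSurjectiveModNGaloisRep p)
    (K : Type) [Field K] [NumberField K] (hK : IsImaginaryQuadratic K)
    [NeZero (W.conductorNorm ℤ)] (hHeeg : SatisfiesHeegnerHypothesis (W.conductorNorm ℤ) K)
    (hodd : Odd (NumberField.discr K)) (hD3 : NumberField.discr K ≠ -3)
    (htor : AddSubgroup.torsionBy (W.baseChange K).toAffine.Point (p : ℤ) = ⊥)
    (hspl : SatisfiesHeegnerHypothesis p K)
    (Dt : ModularParametrizationData W (W.conductorNorm ℤ)) (hopt : Dt.IsPOptimal p)
    (β : ℤ) (hβ : (4 * (W.conductorNorm ℤ : ℤ)) ∣ β ^ 2 - NumberField.discr K) (ι : K →+* ℂ)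
    {n : ℕ} (d : KolyvaginHeegnerData Dt β ι n) {M : ℕ} (hn : n ≠ 1)
    (hsupp : KolyvaginDescent.KolSupp (Zhang2014.IsKolyvaginPrime (W.conductorNorm ℤ) W K p) n)
    (hM : (M : ℕ∞) = Zhang2014.levelIndex W p n)
    {s : ℕ} (hs : s ≤ padicValNat p W.tamagawaProduct) :
    ∃ ξ : galH1Torsion (W.baseChange K) ((p ^ M : ℕ) : ℤ),
      ((p ^ s : ℕ) : ℤ) • ξ = d.kolyvaginClass hp.out M := by
  obtain ⟨hge, -⟩ := h W p h3 hgood hord hsur K hK hHeeg hodd hD3 htor hspl Dt hopt β hβ ι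
  obtain ⟨ξ, hξ⟩ := hge n d M hn hsupp hM
  refine ⟨((p ^ (padicValNat p W.tamagawaProduct - s) : ℕ) : ℤ) • ξ, ?_⟩
  rw [smul_smul, ← Nat.cast_mul, ← pow_add, Nat.add_sub_cancel' hs, hξ]

/-- **Theorem 2 ⇒ the non-vanishing of the Kolyvagin system (the (sur) case): some
`κ_n^Heeg ≠ 0`** (the source, p0004 L63, notes that Kolyvagin's non-vanishing question is
equivalent to the finiteness of `𝓜_∞`): the class that is not
`p^{t+1}`-divisible is in particular non-zero — the companion, under (sur), of the Theorem 1 record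
`BurungaleEtAl2026_exists_kolyvaginClass_ne_zero` (there under (irr), parametrisation existential;
here for every `p`-optimal datum and orientation). PROVED from the fact.
[cite: BurungaleEtAl2026, Thm. 2 and §0.1 (p0004 L63)] -/
theorem exists_kolyvaginClass_ne_zero_of_thm2
    (h : thm2_kolyvaginClass_divisibility_eq_padicValNat_tamagawaProduct)
    (W : WeierstrassCurve ℚ) [W.IsElliptic] [W.IsGloballyMinimal] (p : ℕ) [hp : Fact p.Prime]
    (h3 : 3 < p) (hgood : W.HasGoodReductionAtPrime p) (hord : ¬ (p : ℤ) ∣ W.frobeniusTrace p)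
    (hsur : W.HasSurjectiveModNGaloisRep p)
    (K : Type) [Field K] [NumberField K] (hK : IsImaginaryQuadratic K)
    [NeZero (W.conductorNorm ℤ)] (hHeeg : SatisfiesHeegnerHypothesis (W.conductorNorm ℤ) K)
    (hodd : Odd (NumberField.discr K)) (hD3 : NumberField.discr K ≠ -3)
    (htor : AddSubgroup.torsionBy (W.baseChange K).toAffine.Point (p : ℤ) = ⊥)
    (hspl : SatisfiesHeegnerHypothesis p K)
    (Dt : ModularParametrizationData W (W.conductorNorm ℤ)) (hopt : Dt.IsPOptimal p)
    (β : ℤ) (hβ : (4 * (W.conductorNorm ℤ : ℤ)) ∣ β ^ 2 - NumberField.discr K) (ι : K →+* ℂ) :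
    ∃ (n : ℕ) (d : KolyvaginHeegnerData Dt β ι n) (M : ℕ), n ≠ 1 ∧
      KolyvaginDescent.KolSupp (Zhang2014.IsKolyvaginPrime (W.conductorNorm ℤ) W K p) n ∧
      1 ≤ M ∧ (M : ℕ∞) ≤ Zhang2014.levelIndex W p n ∧ d.kolyvaginClass hp.out M ≠ 0 := by
  obtain ⟨-, n, d, M, hn, hsupp, hM, hndiv⟩ :=
    h W p h3 hgood hord hsur K hK hHeeg hodd hD3 htor hspl Dt hopt β hβ ι
  refine ⟨n, d, M, hn, hsupp, ?_, hM.le, ?_⟩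
  · -- `1 ≤ M = M(n)`: `n ≠ 1` square-free has a prime factor `ℓ`, a Kolyvagin prime, `M(ℓ) ≥ 1`
    have hn0 : n ≠ 0 := hsupp.1.ne_zero
    obtain ⟨ℓ, hℓ⟩ : n.primeFactors.Nonempty := by
      rw [Nat.nonempty_primeFactors]; omega
    have h1 : (1 : ℕ∞) ≤ Zhang2014.levelIndex W p n := by
      rw [show (1 : ℕ∞) = ((1 : ℕ) : ℕ∞) from rfl, Zhang2014.natCast_le_levelIndex_iff]
      intro q hq
      exact (hsupp.2 q hq).2.2.2.2.2
    have : ((1 : ℕ) : ℕ∞) ≤ (M : ℕ∞) := by rw [hM]; exact h1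
    exact_mod_cast this
  · intro h0
    exact hndiv ⟨0, by rw [h0]; exact zsmul_zero _⟩

end BurungaleEtAl2026

end Literature.NumberTheory.EllipticCurves

end
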